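import Mathlib
import HarnessLib
import Literature.Analysis.UnboundedOperators.SpectralGapProofs
import Summits.HubbardSuperconductivity.HubbardSuperconductivity.Theorems.KLProgrammeCooperChannelRiccatiFlowDefs

/-!
# Route `KLProgramme` — DECOMP C2 «ChannelRiccati» in Lean, I: the bottom of the form follows the scalar Riccati step
# (`C2OneStep` PROVED)

Cell gate-hubbard-kl, seat p3 (DECOMP.md v6 §2 C2, App. B, App. E (E2, E.4); crux K3 = `KLRegimeTwoPointLimit`,
stmt-HubbardSuperconductivity-19937, which consumes C2 through Lemma E.4's block-Riccati comparison).  Vocabulary: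
`Theorems/KLProgrammeCooperChannelRiccatiFlowDefs.lean` (`formInf`, `formSup`, `riccatiStep`, `cascadeStep`).

Setting: `E` a complex inner-product space (completeness is needed only to speak of `IsSelfAdjoint`; the working
hypothesis is symmetry, `(T : E →ₗ[ℂ] E).IsSymmetric`), `T` a bounded symmetric operator, `m = formInf T` the bottom of
its quadratic form on the unit sphere.  Main results:

* `abs_formInf_add_sub_le` — form perturbation: `|formInf (A + P) - formInf A| ≤ ‖P‖` for ANY bounded `A, P`;
* `formInf_riccati` — for `|b| ‖T‖ ≤ 1/4`, `formInf (T - b • (T * T)) = riccatiStep b (formInf T)`: the bottom of the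
  form of `T - b T²` IS the scalar Riccati image `m - b m²` of the bottom of `T` (both signs of `b`, so the same statement
  read for `-T` gives the top of the form, file II);
* `abs_formInf_riccati_add_sub_le`, and `c2OneStep` = **`C2OneStep E` of DECOMP App. B verbatim** (for self-adjoint
  `T, P`, `0 ≤ b`, `b ‖T‖ ≤ 1/4`: `|formInf (T - b • (T * T) + P) - riccatiStep b (formInf T)| ≤ ‖P‖`).

Method (elementary — no spectral theorem, no continuous functional calculus).  With `σ(w) = Re ⟪w, T w⟫ - m ‖w‖² ≥ 0`
and `κ(w) = ‖(T - m) w‖²` one has `‖T w‖² = κ(w) + 2 m σ(w) + m² ‖w‖²` (`norm_sq_apply_eq`) and the Cauchy–Schwarz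
GAIN `κ(w) ≤ ‖T - m‖ σ(w) ≤ 2 ‖T‖ σ(w)` for the positive operator `T - m` (`norm_sq_shift_apply_le`, from the tree lemma
`ContinuousLinearMap.IsPositive.norm_apply_sq_le` of `Literature/Analysis/UnboundedOperators/SpectralGapProofs.lean`).
Hence at a unit vector `Re ⟪v, (T - bT²) v⟫ = (m - b m²) + σ (1 - 2 b m) - b κ` with `0 ≤ σ (1 - 2bm) - bκ ≤ 2σ` when
`|b| ‖T‖ ≤ 1/4` (`riccati_core_nonneg/le`): the lower bound is the `≥` half, approximate minimisers (`σ → 0`) give `≤`.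
The cascade map `T (1 + bT)⁻¹` (App. E, E2 (c1)) is treated the same way in file II
(`KLProgrammeCooperChannelRiccatiFlowCascade.lean`).

References: HOME/DECOMP.md v6 §2 C2 / App. B (planner-g2 `Sketch.lean` §C2) / App. E; M. Reed, B. Simon, *Methods of
Modern Mathematical Physics* IV, Thm. XIII.1 (min–max characterisation of the bottom of the spectrum), for orientation only.
-/

noncomputable section

namespace Summit.HubbardSuperconductivity.HubbardSuperconductivity.Theorems.CooperChannelRiccatiFlow

set_option linter.dupNamespace false -- summit = problem name (single-conjunct summit), D-0017

open scoped InnerProductSpace ComplexConjugate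
open RCLike ContinuousLinearMap

variable {E : Type*} [NormedAddCommGroup E] [InnerProductSpace ℂ E]


/-! ## The bottom of the form: order-theoretic API -/

/-- The set whose infimum is `formInf T`. -/
theorem formInf_def (T : E →L[ℂ] E) :
    formInf T = sInf ((fun v : E => re ⟪v, T v⟫_ℂ) '' {v : E | ‖v‖ = 1}) := rfl

/-- `|Re ⟪v, T v⟫| ≤ ‖T‖` for a unit vector `v`. -/
theorem abs_re_inner_apply_le_norm (T : E →L[ℂ] E) {v : E} (hv : ‖v‖ = 1) :
    |re ⟪v, T v⟫_ℂ| ≤ ‖T‖ := by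
  calc |re ⟪v, T v⟫_ℂ| ≤ ‖⟪v, T v⟫_ℂ‖ := RCLike.abs_re_le_norm _
    _ ≤ ‖v‖ * ‖T v‖ := norm_inner_le_norm _ _
    _ ≤ ‖v‖ * (‖T‖ * ‖v‖) := by gcongr; exact T.le_opNorm v
    _ = ‖T‖ := by rw [hv]; ring

/-- The Rayleigh set of `T` on the unit sphere is bounded below (by `-‖T‖`). -/
theorem bddBelow_formSet (T : E →L[ℂ] E) :
    BddBelow ((fun v : E => re ⟪v, T v⟫_ℂ) '' {v : E | ‖v‖ = 1}) := by
  refine ⟨-‖T‖, ?_⟩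
  rintro _ ⟨v, hv, rfl⟩
  exact neg_le_of_abs_le (abs_re_inner_apply_le_norm T hv)

/-- `formInf T ≤ Re ⟪v, T v⟫` for every unit vector `v`. -/
theorem formInf_le (T : E →L[ℂ] E) {v : E} (hv : ‖v‖ = 1) : formInf T ≤ re ⟪v, T v⟫_ℂ :=
  csInf_le (bddBelow_formSet T) ⟨v, hv, rfl⟩

/-- Normalising a nonzero vector (`Mathlib`'s `norm_smul_inv_norm`, recorded in the form used below). -/
theorem norm_normalize {w : E} (hw : w ≠ 0) : ‖((‖w‖ : ℂ)⁻¹) • w‖ = 1 := norm_smul_inv_norm hw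

/-- The form of the normalised vector. -/
theorem re_inner_normalize (T : E →L[ℂ] E) (w : E) :
    re ⟪((‖w‖ : ℂ)⁻¹) • w, T (((‖w‖ : ℂ)⁻¹) • w)⟫_ℂ = ‖w‖⁻¹ ^ 2 * re ⟪w, T w⟫_ℂ := by
  rw [map_smul, inner_smul_left, inner_smul_right]
  simp [RCLike.re_to_complex, pow_two, mul_assoc]

/-- Homogeneous form of `formInf_le`: `formInf T · ‖w‖² ≤ Re ⟪w, T w⟫` for every vector `w`. -/
theorem formInf_mul_norm_sq_le (T : E →L[ℂ] E) (w : E) : formInf T * ‖w‖ ^ 2 ≤ re ⟪w, T w⟫_ℂ := by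
  by_cases hw : w = 0
  · simp [hw]
  · have h := formInf_le T (norm_normalize hw)
    rw [re_inner_normalize] at h
    have := mul_le_mul_of_nonneg_left h (sq_nonneg ‖w‖)
    calc formInf T * ‖w‖ ^ 2 = ‖w‖ ^ 2 * formInf T := by ring
      _ ≤ ‖w‖ ^ 2 * (‖w‖⁻¹ ^ 2 * re ⟪w, T w⟫_ℂ) := this
      _ = re ⟪w, T w⟫_ℂ := by field_simp

/-- On a nontrivial space the unit sphere is nonempty. -/
theorem exists_norm_eq_one [Nontrivial E] : ∃ v : E, ‖v‖ = 1 := by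
  obtain ⟨w, hw⟩ := exists_ne (0 : E)
  exact ⟨_, norm_normalize hw⟩

/-- On a nontrivial space the Rayleigh set on the unit sphere is nonempty. -/
theorem formSet_nonempty [Nontrivial E] (T : E →L[ℂ] E) :
    ((fun v : E => re ⟪v, T v⟫_ℂ) '' {v : E | ‖v‖ = 1}).Nonempty := by
  obtain ⟨v₀, hv₀⟩ := exists_norm_eq_one (E := E)
  exact ⟨_, v₀, hv₀, rfl⟩

/-- A uniform lower bound of the form on the unit sphere is a lower bound of `formInf` (nontrivial space). -/
theorem le_formInf [Nontrivial E] (T : E →L[ℂ] E) {c : ℝ} (h : ∀ v : E, ‖v‖ = 1 → c ≤ re ⟪v, T v⟫_ℂ) :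
    c ≤ formInf T :=
  le_csInf (formSet_nonempty T) (by rintro _ ⟨v, hv, rfl⟩; exact h v hv)

/-- If `formInf T < c` then some unit vector has `Re ⟪v, T v⟫ < c` (nontrivial space). -/
theorem exists_re_inner_lt_of_formInf_lt [Nontrivial E] (T : E →L[ℂ] E) {c : ℝ} (h : formInf T < c) :
    ∃ v : E, ‖v‖ = 1 ∧ re ⟪v, T v⟫_ℂ < c := by
  obtain ⟨_, ⟨v, hv, rfl⟩, hlt⟩ := exists_lt_of_csInf_lt (formSet_nonempty T) h
  exact ⟨v, hv, hlt⟩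

/-- On the zero space `formInf T = 0` (`sInf ∅ = 0`). -/
theorem formInf_of_subsingleton [Subsingleton E] (T : E →L[ℂ] E) : formInf T = 0 := by
  have hset : ((fun v : E => re ⟪v, T v⟫_ℂ) '' {v : E | ‖v‖ = 1}) = ∅ := by
    ext r
    simp only [Set.mem_image, Set.mem_setOf_eq, Set.mem_empty_iff_false, iff_false, not_exists, not_and]
    intro v hv
    rw [Subsingleton.elim v 0, norm_zero] at hv
    exact absurd hv zero_ne_one
  rw [formInf_def, hset, Real.sInf_empty]

/-- `-‖T‖ ≤ formInf T`. -/
theorem neg_norm_le_formInf (T : E →L[ℂ] E) : -‖T‖ ≤ formInf T := by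
  rcases subsingleton_or_nontrivial E with hE | hE
  · rw [formInf_of_subsingleton]; simp
  · exact le_formInf T fun v hv => neg_le_of_abs_le (abs_re_inner_apply_le_norm T hv)

/-- `formInf T ≤ ‖T‖`. -/
theorem formInf_le_norm (T : E →L[ℂ] E) : formInf T ≤ ‖T‖ := by
  rcases subsingleton_or_nontrivial E with hE | hE
  · rw [formInf_of_subsingleton]; exact norm_nonneg _
  · obtain ⟨v, hv⟩ := exists_norm_eq_one (E := E)
    exact (formInf_le T hv).trans (le_of_abs_le (abs_re_inner_apply_le_norm T hv))

/-- `|formInf T| ≤ ‖T‖`. -/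
theorem abs_formInf_le_norm (T : E →L[ℂ] E) : |formInf T| ≤ ‖T‖ :=
  abs_le.mpr ⟨neg_norm_le_formInf T, formInf_le_norm T⟩

/-- **Form perturbation, lower half:** `formInf A - ‖P‖ ≤ formInf (A + P)`. -/
theorem formInf_sub_norm_le_formInf_add (A P : E →L[ℂ] E) : formInf A - ‖P‖ ≤ formInf (A + P) := by
  rcases subsingleton_or_nontrivial E with hE | hE
  · rw [formInf_of_subsingleton, formInf_of_subsingleton]; simp
  · refine le_formInf _ fun v hv => ?_
    rw [show (A + P) v = A v + P v from rfl, inner_add_right, map_add]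
    have h1 := formInf_le A hv
    have h2 := neg_le_of_abs_le (abs_re_inner_apply_le_norm P hv)
    linarith

/-- **Form perturbation:** `|formInf (A + P) - formInf A| ≤ ‖P‖` — a bounded (not necessarily self-adjoint) remainder
moves the bottom of the form by at most its norm. -/
theorem abs_formInf_add_sub_le (A P : E →L[ℂ] E) : |formInf (A + P) - formInf A| ≤ ‖P‖ := by
  rw [abs_le]
  refine ⟨by linarith [formInf_sub_norm_le_formInf_add A P], ?_⟩
  have h := formInf_sub_norm_le_formInf_add (A + P) (-P)
  rw [add_neg_cancel_right, norm_neg] at h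
  linarith


/-! ## The shifted operator `T - m` (`m = formInf T`): positivity and the Cauchy–Schwarz gain

For a symmetric `T` with bottom `m = formInf T` write `σ(w) = Re ⟪w, T w⟫ - m ‖w‖² ≥ 0` for the shifted form and
`κ(w) = ‖T w‖² - m² ‖w‖² - 2 m σ(w)`; then `κ(w) = ‖(T - m) w‖²` and, by the Cauchy–Schwarz inequality for the positive
operator `T - m` (tree lemma `ContinuousLinearMap.IsPositive.norm_apply_sq_le`), `0 ≤ κ(w) ≤ 2 ‖T‖ σ(w)`.  Every
comparison theorem below is scalar algebra on top of these two inequalities. -/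

section Shift

variable {T : E →L[ℂ] E}

/-- The shifted form is nonnegative: `0 ≤ Re ⟪w, T w⟫ - formInf T · ‖w‖²`. -/
theorem shiftedForm_nonneg (T : E →L[ℂ] E) (w : E) : 0 ≤ re ⟪w, T w⟫_ℂ - formInf T * ‖w‖ ^ 2 :=
  sub_nonneg.mpr (formInf_mul_norm_sq_le T w)

/-- Pointwise action of the shifted operator `T - m`. -/
theorem shift_apply (T : E →L[ℂ] E) (m : ℝ) (w : E) :
    (T - (m : ℂ) • (1 : E →L[ℂ] E)) w = T w - (m : ℂ) • w := rfl

/-- `Re ⟪(T - m) w, w⟫ = Re ⟪w, T w⟫ - m ‖w‖²`. -/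
theorem re_inner_shift_apply (T : E →L[ℂ] E) (m : ℝ) (w : E) :
    re ⟪(T - (m : ℂ) • (1 : E →L[ℂ] E)) w, w⟫_ℂ = re ⟪w, T w⟫_ℂ - m * ‖w‖ ^ 2 := by
  rw [shift_apply, inner_sub_left, map_sub, inner_re_symm, inner_smul_left, Complex.conj_ofReal,
    ← inner_self_eq_norm_sq (𝕜 := ℂ)]
  simp [RCLike.re_to_complex]

/-- The shifted operator `T - formInf T` of a symmetric `T` is positive. -/
theorem isPositive_shift (hT : (T : E →ₗ[ℂ] E).IsSymmetric) :
    (T - (formInf T : ℂ) • (1 : E →L[ℂ] E)).IsPositive := by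
  refine ⟨?_, fun w => ?_⟩
  · intro x y
    show ⟪(T - (formInf T : ℂ) • (1 : E →L[ℂ] E)) x, y⟫_ℂ = ⟪x, (T - (formInf T : ℂ) • (1 : E →L[ℂ] E)) y⟫_ℂ
    rw [shift_apply, shift_apply, inner_sub_left, inner_sub_right, inner_smul_left, inner_smul_right,
      Complex.conj_ofReal, hT.apply_clm x y]
  · rw [reApplyInnerSelf_apply, re_inner_shift_apply]
    exact shiftedForm_nonneg T w

/-- `‖T w‖² = ‖(T - m) w‖² + 2 m (Re ⟪w, T w⟫ - m ‖w‖²) + m² ‖w‖²` for every bounded `T` and real `m`. -/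
theorem norm_sq_apply_eq (T : E →L[ℂ] E) (m : ℝ) (w : E) :
    ‖T w‖ ^ 2 = ‖T w - (m : ℂ) • w‖ ^ 2 + 2 * m * (re ⟪w, T w⟫_ℂ - m * ‖w‖ ^ 2) + m ^ 2 * ‖w‖ ^ 2 := by
  have h := @norm_sub_sq ℂ E _ _ _ (T w) ((m : ℂ) • w)
  have h1 : re ⟪T w, (m : ℂ) • w⟫_ℂ = m * re ⟪w, T w⟫_ℂ := by
    rw [inner_smul_right, inner_re_symm]
    simp [RCLike.re_to_complex]
  have h2 : ‖(m : ℂ) • w‖ ^ 2 = m ^ 2 * ‖w‖ ^ 2 := by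
    rw [norm_smul, Complex.norm_real, Real.norm_eq_abs, mul_pow, sq_abs]
  rw [h1, h2] at h
  linarith [h]

/-- **The Cauchy–Schwarz gain.** For symmetric `T` with `m = formInf T`:
`‖(T - m) w‖² ≤ 2 ‖T‖ · (Re ⟪w, T w⟫ - m ‖w‖²)` (the shifted operator is positive with norm `≤ ‖T‖ + |m| ≤ 2‖T‖`). -/
theorem norm_sq_shift_apply_le (hT : (T : E →ₗ[ℂ] E).IsSymmetric) (w : E) :
    ‖T w - (formInf T : ℂ) • w‖ ^ 2 ≤ 2 * ‖T‖ * (re ⟪w, T w⟫_ℂ - formInf T * ‖w‖ ^ 2) := by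
  set S : E →L[ℂ] E := T - (formInf T : ℂ) • (1 : E →L[ℂ] E) with hS
  have hpos : S.IsPositive := isPositive_shift hT
  have hcs := hpos.norm_apply_sq_le w
  rw [hS, re_inner_shift_apply, shift_apply] at hcs
  have hnormS : ‖S‖ ≤ 2 * ‖T‖ := by
    calc ‖S‖ ≤ ‖T‖ + ‖(formInf T : ℂ) • (1 : E →L[ℂ] E)‖ := norm_sub_le _ _
      _ ≤ ‖T‖ + |formInf T| * 1 := by
          rw [norm_smul, Complex.norm_real, Real.norm_eq_abs]
          gcongr
          rw [ContinuousLinearMap.one_def]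
          exact ContinuousLinearMap.norm_id_le
      _ ≤ ‖T‖ + ‖T‖ * 1 := by gcongr; exact abs_formInf_le_norm T
      _ = 2 * ‖T‖ := by ring
  rw [hS] at hnormS
  calc ‖T w - (formInf T : ℂ) • w‖ ^ 2
      ≤ ‖T - (formInf T : ℂ) • (1 : E →L[ℂ] E)‖ * (re ⟪w, T w⟫_ℂ - formInf T * ‖w‖ ^ 2) := hcs
    _ ≤ 2 * ‖T‖ * (re ⟪w, T w⟫_ℂ - formInf T * ‖w‖ ^ 2) := by
          gcongr
          exact shiftedForm_nonneg T w

end Shift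


/-- The two shifted-form inequalities at a UNIT vector `u` (symmetric `T`, `m = formInf T`):
`0 ≤ Re ⟪u, T u⟫ - m` and `‖T u - m u‖² ≤ 2 ‖T‖ (Re ⟪u, T u⟫ - m)`. -/
theorem shift_bounds_unit {T : E →L[ℂ] E} (hT : (T : E →ₗ[ℂ] E).IsSymmetric) {u : E} (hu : ‖u‖ = 1) :
    0 ≤ re ⟪u, T u⟫_ℂ - formInf T ∧
      ‖T u - (formInf T : ℂ) • u‖ ^ 2 ≤ 2 * ‖T‖ * (re ⟪u, T u⟫_ℂ - formInf T) := by
  have h1 := shiftedForm_nonneg T u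
  have h2 := norm_sq_shift_apply_le hT u
  rw [hu, one_pow, mul_one] at h1 h2
  exact ⟨h1, h2⟩

/-! ## Scalar cores of the two comparison theorems -/

section Scalar

/-- `|b m| ≤ 1/4` from `|m| ≤ N`, `|b| N ≤ 1/4`. -/
theorem abs_mul_le_quarter {b m N : ℝ} (hm : |m| ≤ N) (hb : |b| * N ≤ 1 / 4) : |b * m| ≤ 1 / 4 := by
  calc |b * m| = |b| * |m| := abs_mul b m
    _ ≤ |b| * N := by gcongr
    _ ≤ 1 / 4 := hb

/-- `|b κ| ≤ σ/2` from `0 ≤ κ ≤ 2 N σ`, `|b| N ≤ 1/4`. -/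
theorem abs_mul_le_half {b σ κ N : ℝ} (hσ : 0 ≤ σ) (hκ0 : 0 ≤ κ) (hκ : κ ≤ 2 * N * σ)
    (hb : |b| * N ≤ 1 / 4) : |b * κ| ≤ σ / 2 := by
  calc |b * κ| = |b| * κ := by rw [abs_mul, abs_of_nonneg hκ0]
    _ ≤ |b| * (2 * N * σ) := by gcongr
    _ = 2 * (|b| * N) * σ := by ring
    _ ≤ 2 * (1 / 4) * σ := by gcongr
    _ = σ / 2 := by ring

/-- Scalar core of the Riccati comparison, lower half: `0 ≤ σ (1 - 2 b m) - b κ`. -/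
theorem riccati_core_nonneg {b m σ κ N : ℝ} (hσ : 0 ≤ σ) (hκ0 : 0 ≤ κ) (hκ : κ ≤ 2 * N * σ)
    (hm : |m| ≤ N) (hb : |b| * N ≤ 1 / 4) : 0 ≤ σ * (1 - 2 * b * m) - b * κ := by
  have h1 := abs_le.mp (abs_mul_le_quarter hm hb)
  have h2 := abs_le.mp (abs_mul_le_half hσ hκ0 hκ hb)
  nlinarith

/-- Scalar core of the Riccati comparison, upper half: `σ (1 - 2 b m) - b κ ≤ 2 σ`. -/
theorem riccati_core_le {b m σ κ N : ℝ} (hσ : 0 ≤ σ) (hκ0 : 0 ≤ κ) (hκ : κ ≤ 2 * N * σ)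
    (hm : |m| ≤ N) (hb : |b| * N ≤ 1 / 4) : σ * (1 - 2 * b * m) - b * κ ≤ 2 * σ := by
  have h1 := abs_le.mp (abs_mul_le_quarter hm hb)
  have h2 := abs_le.mp (abs_mul_le_half hσ hκ0 hκ hb)
  nlinarith

/-- Scalar core of the cascade comparison, lower half: `0 ≤ σ (1 + b m) + b κ`. -/
theorem cascade_core_nonneg {b m σ κ N : ℝ} (hσ : 0 ≤ σ) (hκ0 : 0 ≤ κ) (hκ : κ ≤ 2 * N * σ)
    (hm : |m| ≤ N) (hb : |b| * N ≤ 1 / 4) : 0 ≤ σ * (1 + b * m) + b * κ := by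
  have h1 := abs_le.mp (abs_mul_le_quarter hm hb)
  have h2 := abs_le.mp (abs_mul_le_half hσ hκ0 hκ hb)
  nlinarith

/-- Scalar core of the cascade comparison, upper half: `σ (1 + b m) + b κ ≤ 2 σ`. -/
theorem cascade_core_le {b m σ κ N : ℝ} (hσ : 0 ≤ σ) (hκ0 : 0 ≤ κ) (hκ : κ ≤ 2 * N * σ)
    (hm : |m| ≤ N) (hb : |b| * N ≤ 1 / 4) : σ * (1 + b * m) + b * κ ≤ 2 * σ := by
  have h1 := abs_le.mp (abs_mul_le_quarter hm hb)
  have h2 := abs_le.mp (abs_mul_le_half hσ hκ0 hκ hb)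
  nlinarith

end Scalar

/-! ## The polynomial (Riccati) step `T ↦ T - b T²` -/

section Riccati

variable {T : E →L[ℂ] E}

/-- Real scalar multiples act through the complex ones: `(b • A) w = (b : ℂ) • A w`. -/
theorem real_smul_apply (b : ℝ) (A : E →L[ℂ] E) (w : E) : (b • A) w = (b : ℂ) • A w := by
  show b • A w = _
  rw [Complex.coe_smul]

/-- `Re ⟪x, (b : ℂ) • y⟫ = b · Re ⟪x, y⟫` for real `b`. -/
theorem re_inner_real_smul_right (b : ℝ) (x y : E) : re ⟪x, (b : ℂ) • y⟫_ℂ = b * re ⟪x, y⟫_ℂ := by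
  rw [inner_smul_right]
  simp [RCLike.re_to_complex]

/-- `Re ⟪(b : ℂ) • x, y⟫ = b · Re ⟪x, y⟫` for real `b`. -/
theorem re_inner_real_smul_left (b : ℝ) (x y : E) : re ⟪(b : ℂ) • x, y⟫_ℂ = b * re ⟪x, y⟫_ℂ := by
  rw [inner_smul_left, Complex.conj_ofReal]
  simp [RCLike.re_to_complex]

/-- The form of `T - b T²` at `v`: `Re ⟪v, T v⟫ - b ‖T v‖²` (symmetric `T`). -/
theorem re_inner_riccati_apply (hT : (T : E →ₗ[ℂ] E).IsSymmetric) (b : ℝ) (v : E) :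
    re ⟪v, (T - b • (T * T)) v⟫_ℂ = re ⟪v, T v⟫_ℂ - b * ‖T v‖ ^ 2 := by
  have h1 : (T - b • (T * T)) v = T v - (b : ℂ) • T (T v) := by
    show T v - (b • (T * T)) v = _
    rw [real_smul_apply]
    rfl
  rw [h1, inner_sub_right, map_sub, re_inner_real_smul_right, ← hT.apply_clm v (T v),
    inner_self_eq_norm_sq (𝕜 := ℂ)]

/-- **The bottom of the form of `T - b T²` is the Riccati image of the bottom of `T`.**  For a symmetric bounded `T`
on a complex inner-product space and a real `b` with `|b| ‖T‖ ≤ 1/4`,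
`formInf (T - b T²) = riccatiStep b (formInf T) = formInf T - b (formInf T)²`.
(The scalar map `x ↦ x - b x²` is increasing on `[-‖T‖, ‖T‖]`; no spectral theorem is used: the lower bound is the
positivity of `(T - m)(1 - b (T + m))` through the Cauchy–Schwarz gain, the upper bound uses approximate minimisers.) -/
theorem formInf_riccati (hT : (T : E →ₗ[ℂ] E).IsSymmetric) {b : ℝ} (hb : |b| * ‖T‖ ≤ 1 / 4) :
    formInf (T - b • (T * T)) = riccatiStep b (formInf T) := by
  rcases subsingleton_or_nontrivial E with hE | hE
  · simp [formInf_of_subsingleton, riccatiStep]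
  set m := formInf T with hm_def
  have hmN : |m| ≤ ‖T‖ := abs_formInf_le_norm T
  -- the value of the form at a unit vector, organised around the shifted quantities `σ`, `κ`
  have hval : ∀ v : E, ‖v‖ = 1 →
      re ⟪v, (T - b • (T * T)) v⟫_ℂ = riccatiStep b m +
        ((re ⟪v, T v⟫_ℂ - m) * (1 - 2 * b * m) - b * ‖T v - (m : ℂ) • v‖ ^ 2) := by
    intro v hv
    rw [re_inner_riccati_apply hT, norm_sq_apply_eq T m v, riccatiStep, hv]
    ring
  apply le_antisymm
  · refine le_of_forall_pos_lt_add fun ε hε => ?_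
    obtain ⟨v, hv, hlt⟩ := exists_re_inner_lt_of_formInf_lt T (show formInf T < m + ε / 2 by linarith)
    obtain ⟨hσ, hκ⟩ := shift_bounds_unit hT hv
    rw [← hm_def] at hσ hκ
    have hcore := riccati_core_le hσ (sq_nonneg _) hκ hmN hb
    calc formInf (T - b • (T * T)) ≤ re ⟪v, (T - b • (T * T)) v⟫_ℂ := formInf_le _ hv
      _ ≤ riccatiStep b m + 2 * (re ⟪v, T v⟫_ℂ - m) := by rw [hval v hv]; linarith
      _ < riccatiStep b m + ε := by linarith
  · refine le_formInf _ fun v hv => ?_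
    obtain ⟨hσ, hκ⟩ := shift_bounds_unit hT hv
    rw [← hm_def] at hσ hκ
    have hcore := riccati_core_nonneg hσ (sq_nonneg _) hκ hmN hb
    rw [hval v hv]
    linarith

/-- **C2-one-step.** For symmetric bounded `T`, any bounded `P` and a real `b` with `|b| ‖T‖ ≤ 1/4`:
`|formInf (T - b T² + P) - riccatiStep b (formInf T)| ≤ ‖P‖`. -/
theorem abs_formInf_riccati_add_sub_le (hT : (T : E →ₗ[ℂ] E).IsSymmetric) {b : ℝ}
    (hb : |b| * ‖T‖ ≤ 1 / 4) (P : E →L[ℂ] E) :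
    |formInf (T - b • (T * T) + P) - riccatiStep b (formInf T)| ≤ ‖P‖ := by
  rw [← formInf_riccati hT hb]
  exact abs_formInf_add_sub_le _ P

/-- **`C2OneStep E` of DECOMP App. B, verbatim** (planner g2's shape of record; the self-adjointness of `P` and the
sign of `b` are not needed and kept only to match the shape): for self-adjoint bounded `T, P` on a complex Hilbert
space and `0 ≤ b` with `b ‖T‖ ≤ 1/4`, `|formInf (T - b • (T * T) + P) - riccatiStep b (formInf T)| ≤ ‖P‖`. -/
theorem c2OneStep [CompleteSpace E] :
    ∀ (T P : E →L[ℂ] E) (b : ℝ), IsSelfAdjoint T → IsSelfAdjoint P → 0 ≤ b → b * ‖T‖ ≤ 1 / 4 →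
      |formInf (T - b • (T * T) + P) - riccatiStep b (formInf T)| ≤ ‖P‖ := by
  intro T P b hT _hP hb hbT
  have hT' : (T : E →ₗ[ℂ] E).IsSymmetric := ContinuousLinearMap.isSelfAdjoint_iff_isSymmetric.mp hT
  exact abs_formInf_riccati_add_sub_le hT' (by rwa [abs_of_nonneg hb]) P

end Riccati

end Summit.HubbardSuperconductivity.HubbardSuperconductivity.Theorems.CooperChannelRiccatiFlow

end
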